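import Literature.Computability.Cryptography.RegevStagePost
import Literature.Computability.QuantumComplexity.CWrapReadLaw
import Literature.Computability.QuantumComplexity.SeqChainLaw
import HarnessLib

/-!
# Regev 2009, Theorem 3.1 in machine form, V: the stage family as `N` parallel copies of a one-sample machine

Topic `Computability/Cryptography` (family `pqc`), sequel of `RegevStageKernelLaws.lean` (pqc.S19, SIVP
form, from KERNEL-level laws (BOOT)/(FAC)/(STEP)/(PASS) of one stage family `S`) and
`RegevStagePost.lean` (batch codes, the collecting post-processor `postG`). Here the stage family is
CONSTRUCTED from a ONE-SAMPLE stage machine `Q` — the machine of Regev's proof of Theorem 3.1 proper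
(author's version arXiv:2401.03703, p. 15): at every level the iterative step (Lemma 3.3), which
"given `n^c` samples from `D_{L,r}` produces a sample from `D_{L,r√n/(αq)}`", is applied `n^c` times
to the SAME input samples ("the output distribution is taken with respect to the randomness (and
quantum measurements) used in the algorithm, and not with respect to the input samples … from the same
set of `n^c` samples we can produce any polynomial number of samples", note after Lemma 3.3), the
`n^c` runs being independent given the input samples:

  `S = CWrap(⟨·, ε⟩, PolyCopiesIdx(Q, K = p_N(|u|) + 1 copies), postG)`

(`QuantumComplexity/CWrap*.lean`, `QuantumComplexity/PolyCopiesIdx*.lean`): on the stage input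
`z = ⟨x, ⟨1ᵏ, y⟩⟩` the copies run `Q` on `⟨z, e_j⟩` (`e_j` the one-hot index word), on pairwise
disjoint wires, and the post-processor collects the vector codes written by the first `N = p_N(n)`
copies at the front of their segments into a batch code followed by a padding.

Proved here (no named fact; the hypotheses on `Q` are binders):

* the machine (`StageCopies.Machine`, `nonempty_machine`, `Machine.S`) and its layout (`K_eq`, `N_le_K`,
  `inputIdx_eq`: copy `j` runs on `⟨z, e_j⟩`, `offOf_eq_blk`);
* support facts: the segments of a measured register of the copies family are possible outputs of the
  copies (`segment_mem_support`), the wrapped family's outputs start with the post-processed string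
  (`exists_of_mem_support_S'`, from `CWrap.support_kernel_subset`), hence — when every output of `Q` starts with a short framed vector code
  (hypothesis (CODE)) — the window handed to the next stage IS the batch code of the decoded segments,
  canonically padded (`window_eq`), and the decoded batch law of the stage IS the push-forward of the law
  of the copies' register (`map_readBatchE_window_eq`), which is the independent product of the one-copy
  decoded laws (`map_vOf_eq_indepLaw`, from `PolyCopiesIdx.kernel_map_segments`);
* **`StageCopies.kernelLaws_of_oneCopy`**: the one-copy hypotheses (CODE), (BOOT₁), (STEP₁), (PASS₁) on
  `Q` (module docstring of `RegevStageKernelLaws.lean` for their stage-level counterparts) imply the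
  kernel-level hypothesis of `thm_3_1_stage_of_kernelLaws`, with `N = p_N(n)`, window
  `mS = p_N · (2L + 2)`, `ν_S = N · ν₁` (hybrid argument over the `N` independent copies,
  `tvDist_indepLaw_le`; Goldreich 2001, §3.2.3) and per-batch failure bound `F = N · F₁`; hence
  **`regev_lwe_to_sivp_quantum_of_oneCopy`**: pqc.S19 (SIVP form) from a one-sample stage machine.

## References

* O. Regev, *On lattices, learning with errors, random linear codes, and cryptography*, J. ACM 56
  (2009), art. 34; author's version arXiv:2401.03703: Theorem 3.1 (proof, p. 15), Lemma 3.3 and the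
  note following it [Regev2009].
* C. H. Bennett, E. Bernstein, G. Brassard, U. Vazirani, *Strengths and weaknesses of quantum
  computing*, SIAM J. Comput. 26 (1997), Thm. 4.13–4.14 (independent copies on disjoint wires)
  [BennettBernsteinBrassardVazirani1997].
* O. Goldreich, *Foundations of Cryptography* I, CUP 2001, §3.2.3 (hybrid argument) [Goldreich2001].
* M. A. Nielsen, I. L. Chuang, *Quantum Computation and Quantum Information*, CUP 2010, §2.2.8
  (measurement statistics of product states) [NielsenChuang2010].
-/

noncomputable section

namespace Literature.Computability.Cryptography

namespace Regev2009

namespace StageCopies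

open _root_.Computability Polynomial Literature.Computability.Complexity QuantumComplexity Filter
  Literature.Algebra.EuclideanLattices Literature.Probability.Distributions Literature.Computability.Cryptography.LWE
open scoped ENNReal

/-! ### The machine -/

section Construction

/-- **The window polynomial**: `mS = p_N · (2L + 2)` bounds the length of a batch code of `p_N(n)`
vectors with codes of length `≤ L(|x|)` (`length_encBatch_le`). [folklore] -/
def mSOf (pN L : Polynomial ℕ) : Polynomial ℕ := pN * (2 * L + 2)

/-- Value of the window polynomial. [folklore] -/
@[simp] theorem eval_mSOf (pN L : Polynomial ℕ) (t : ℕ) : (mSOf pN L).eval t = pN.eval t * (2 * L.eval t + 2) := by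
  simp [mSOf]

/-- **The data of the stage family** built on the one-sample machine `Q`: a polynomial ancilla bound of
`Q` (for the layout of the copies) and the parameters of the outer classical wrap — pre-processor
`⟨·, ε⟩`, wrapped family the indexed copies of `Q` (`p_N(|u|) + 1` copies on `u`), post-processor
`postG`. [cite: Regev2009, Theorem 3.1 (proof, p. 15)] -/
structure Machine (Q : UniformQCircuitFamily) (pN L : Polynomial ℕ) where
  /-- a polynomial bound of the ancillas of `Q` -/
  pF : Polynomial ℕ
  /-- the bound -/
  hpF : ∀ m, Q.family.ancillas m ≤ pF.eval m
  /-- the parameters of the outer classical wrap -/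
  Pout : CWrap.Params
  /-- its pre-processor is `⟨·, ε⟩` -/
  hPh : Pout.h = GMSSParallel.hOut
  /-- its post-processor is the collecting map -/
  hPg : Pout.g = StagePost.postG ⟨Q.family, pF, hpF, pN⟩ pN (mSOf pN L)
  /-- it wraps the indexed copies of `Q` -/
  hPF : Pout.F = PolyCopiesIdx.family ⟨Q.family, pF, hpF, pN⟩

namespace Machine

variable {Q : UniformQCircuitFamily} {pN L : Polynomial ℕ} (M : Machine Q pN L)

/-- The parameters of the indexed copies. [folklore] -/
def Pc : PolyCopies.Params := ⟨Q.family, M.pF, M.hpF, pN⟩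

/-- The indexed-copies family. [folklore] -/
def PC : QCircuitFamily cliffordT := PolyCopiesIdx.family M.Pc

/-- The outer wrap wraps `PC`. [folklore] -/
theorem hPF' : M.Pout.F = M.PC := M.hPF

/-- The post-processor, over `Pc`. [folklore] -/
theorem hPg' : M.Pout.g = StagePost.postG M.Pc pN (mSOf pN L) := M.hPg

/-- `PC` is uniform. [folklore] -/
theorem PC_isUniform : M.PC.IsUniform := PolyCopiesIdx.family_isUniform M.Pc Q.isUniform

/-- `PC` is oracle-free. [folklore] -/
theorem PC_isOracleFree : M.PC.IsOracleFree := PolyCopiesIdx.family_isOracleFree M.Pc Q.isOracleFree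

/-- **The stage family**: the outer classical wrap, a poly-time uniform oracle-free family.
[cite: Regev2009, Theorem 3.1 (proof, p. 15)] -/
def S : UniformQCircuitFamily where
  family := CWrap.family M.Pout
  isOracleFree := CWrap.family_isOracleFree M.Pout (by rw [M.hPF']; exact M.PC_isOracleFree)
  isUniform := CWrap.family_isUniform M.Pout (by rw [M.hPF']; exact M.PC_isUniform)

end Machine

/-- **The machine exists.** [folklore] -/
theorem nonempty_machine (Q : UniformQCircuitFamily) (pN L : Polynomial ℕ) : Nonempty (Machine Q pN L) := by
  obtain ⟨pF, hpF⟩ := QCircuitFamily.IsUniform.isPolySize_holds Q.isUniform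
  have hMunif : (PolyCopiesIdx.family ⟨Q.family, pF, fun k => (hpF k).2, pN⟩).IsUniform :=
    PolyCopiesIdx.family_isUniform _ Q.isUniform
  obtain ⟨Pout, hPh, hPg, hPF⟩ := CWrap.exists_params GMSSParallel.hOut_mem_FP
    (StagePost.postG_mem_FP ⟨Q.family, pF, fun k => (hpF k).2, pN⟩ pN (mSOf pN L)) hMunif
  exact ⟨⟨pF, fun k => (hpF k).2, Pout, hPh, hPg, hPF⟩⟩

end Construction

/-! ### Layout -/

section Layout

variable {Q : UniformQCircuitFamily} {pN L : Polynomial ℕ} (M : Machine Q pN L) (I : LatticeInstance) (r : ℚ) (k : ℕ)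
  (y : List Bool)

/-- The input `u = ⟨z, ε⟩` of the copies family on the stage input `z = ⟨x, ⟨1ᵏ, y⟩⟩`. [folklore] -/
def uOf : List Bool := boolPair (StagePost.zOf I r k y) []

/-- `|u| = 2|z| + 2`. [folklore] -/
theorem length_uOf : (uOf I r k y).length = StagePost.mOf I r k y := by
  rw [uOf, length_boolPair, List.length_nil, add_zero, StagePost.mOf]

/-- The pre-processor maps `z` to `u`. [folklore] -/
theorem h_zOf : M.Pout.h (StagePost.zOf I r k y) = uOf I r k y := by
  rw [M.hPh, GMSSParallel.hOut_apply, uOf]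

/-- **The number of copies** `K = p_N(|u|) + 1`. [folklore] -/
theorem K_eq : PolyCopiesIdx.K M.Pc (uOf I r k y).length = pN.eval (StagePost.mOf I r k y) + 1 := by
  rw [PolyCopiesIdx.K, length_uOf]; rfl

/-- **The number of copies as a function of the stage input**: `K = p_N(2|z| + 2) + 1` (the one-sample
machine may rely on this to delimit the index word `e_j` it receives). [folklore] -/
def KOf (pN : Polynomial ℕ) (x : List Bool) (k : ℕ) (y : List Bool) : ℕ := pN.eval (2 * (stageInput x k y).length + 2) + 1

/-- The number of copies is `KOf`. [folklore] -/
theorem K_uOf : PolyCopiesIdx.K M.Pc (uOf I r k y).length = KOf pN (GapSVPInstance.encode (I, r)) k y := by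
  rw [K_eq]; rfl

/-- `n ≤ |u|`. [folklore] -/
theorem n_le_mOf : I.n ≤ StagePost.mOf I r k y := by
  have h := StagePost.n_le_length_encode I r
  rw [StagePost.mOf, StagePost.zOf, length_stageInput]
  omega

/-- **There are more copies than collected samples**: `p_N(n) ≤ K` (indeed `<`). [folklore] -/
theorem N_lt_K : pN.eval I.n < PolyCopiesIdx.K M.Pc (uOf I r k y).length := by
  rw [K_eq]
  exact Nat.lt_succ_of_le (TM2Iter.eval_mono pN (n_le_mOf I r k y))

/-- The one-hot index word of copy `j` among `K`. [folklore] -/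
def idxWord (K j : ℕ) : List Bool := List.ofFn fun j' : Fin K => decide ((j' : ℕ) = j)

/-- Index words along an equality of lengths. [folklore] -/
theorem idxWord_eq {K K' : ℕ} (h : K = K') (j : ℕ) : idxWord K j = idxWord K' j := by rw [h]

/-- **The input of copy `j` is `⟨z, e_j⟩`**, `e_j` the one-hot index word of length `K = KOf`.
[cite: BennettBernsteinBrassardVazirani1997, Thm. 4.14 (proof)] -/
theorem inputIdx_eq (j : ℕ) : PolyCopiesIdx.inputIdx M.Pc (uOf I r k y) j =
    boolPair (StagePost.zOf I r k y) (idxWord (KOf pN (GapSVPInstance.encode (I, r)) k y) j) := by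
  rw [PolyCopiesIdx.inputIdx, uOf, LWE.AmpBricks.boolPair_nil_append, ← idxWord_eq (K_uOf M I r k y)]
  rfl

/-- **The first wire of copy `j` is the post-processor's offset.** [folklore] -/
theorem offOf_eq_blk (j : ℕ) : StagePost.offOf M.Pc I r k y j = PolyCopiesIdx.blk M.Pc (uOf I r k y).length j 0 := by
  rw [StagePost.offOf, PolyCopiesIdx.blk, length_uOf, add_zero]

end Layout

/-! ### Supports -/

section Support

variable {Q : UniformQCircuitFamily} {pN L : Polynomial ℕ} (M : Machine Q pN L)

/-- **The segments of a possible measured register of the copies family are possible outputs of the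
copies** (the law of the segments is the independent product of the copies' output laws,
`PolyCopiesIdx.kernel_map_segments`). [cite: NielsenChuang2010, §2.2.8] -/
theorem segment_mem_support (u : List Bool) {Y : List Bool} (hY : Y ∈ (M.PC.kernel 0 u).support)
    (j : Fin (PolyCopiesIdx.K M.Pc u.length)) :
    PolyCopiesIdx.segment M.Pc u.length Y j ∈ (Q.family.kernel 0 (PolyCopiesIdx.inputIdx M.Pc u j)).support := by
  have hmem : (fun j : Fin (PolyCopiesIdx.K M.Pc u.length) => PolyCopiesIdx.segment M.Pc u.length Y j) ∈
      (indepLaw (PolyCopiesIdx.K M.Pc u.length) fun j => PolyCopiesIdx.blockLaw M.Pc u j).support := by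
    rw [← PolyCopiesIdx.kernel_map_segments, PMF.mem_support_map_iff]
    exact ⟨Y, hY, rfl⟩
  rw [PMF.mem_support_iff, indepLaw_apply, Finset.prod_ne_zero_iff] at hmem
  have h := hmem j (Finset.mem_univ j)
  change _ ∈ (M.Pc.F.kernel 0 (PolyCopiesIdx.inputIdx M.Pc u j)).support
  rw [← PolyCopiesIdx.blockLaw_eq_kernel, PMF.mem_support_iff]
  exact h

/-- **Every possible output of the stage family starts with the post-processed string** of a possible
register of the copies family (`CWrap.support_kernel_subset`). [cite: BernsteinVazirani1997, §8] -/
theorem exists_of_mem_support_S' (I : LatticeInstance) (r : ℚ) (k : ℕ) (y : List Bool) {w : List Bool}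
    (hw : w ∈ ((M.S).kernel (StagePost.zOf I r k y)).support) :
    ∃ Y ∈ (M.PC.kernel 0 (uOf I r k y)).support,
      StagePost.postG M.Pc pN (mSOf pN L) (boolPair (StagePost.zOf I r k y) Y) <+: w := by
  have h := CWrap.support_kernel_subset M.Pout (StagePost.zOf I r k y) hw
  rw [M.hPF', h_zOf M, M.hPg'] at h
  exact h

/-- The outputs of the copies family have length `W`. [folklore] -/
theorem length_of_mem_support_PC (u : List Bool) {Y : List Bool} (hY : Y ∈ (M.PC.kernel 0 u).support) :
    Y.length = PolyCopiesIdx.W M.Pc u.length := by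
  rw [M.PC.length_of_mem_support_kernel 0 u hY]
  exact PolyCopiesIdx.n_add_anc (P := M.Pc) u.length

end Support

/-! ### The items, the window and the decoded law under hypothesis (CODE) -/

section Laws

variable {Q : UniformQCircuitFamily} {pN L : Polynomial ℕ} (M : Machine Q pN L) (I : LatticeInstance) (r : ℚ)

/-- **The batch decoded from the first `N = p_N(n)` segments** of a measured register `Y` of the copies
family (on the stage input `⟨x, ⟨1ᵏ, y⟩⟩`). [cite: Regev2009, Theorem 3.1 (proof, p. 15: the n^c samples)] -/
def vOf (k : ℕ) (y Y : List Bool) : Fin (pN.eval I.n) → Fin I.n → ℤ :=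
  fun j => decodeLatticeVector I.n (PolyCopiesIdx.segment M.Pc (uOf I r k y).length Y j)

/-- **Hypothesis (CODE)** for the instance `(I, r)`: every possible output of `Q` on a copy input
`⟨⟨x, ⟨1ᵏ, y⟩⟩, e_j⟩` starts with the framed code of the vector the `DGS` reader reads off it, and that
code has length `≤ L(|x|)`. (A predicate on the data, used as a hypothesis binder.) [folklore] -/
def Code (Q : UniformQCircuitFamily) (pN L : Polynomial ℕ) (I : LatticeInstance) (r : ℚ) : Prop :=
  ∀ (k : ℕ) (y : List Bool) (j : ℕ) (s : List Bool),
    s ∈ (Q.kernel (boolPair (stageInput (GapSVPInstance.encode (I, r)) k y)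
      (idxWord (KOf pN (GapSVPInstance.encode (I, r)) k y) j))).support →
    boolPair (vecCode I.n (decodeLatticeVector I.n s)) [] <+: s ∧
      (vecCode I.n (decodeLatticeVector I.n s)).length ≤ L.eval (GapSVPInstance.encode (I, r)).length

variable {M I r}

/-- **Under (CODE), the items collected by the post-processor are the codes of the decoded segments**,
of length `≤ L(|x|)`. [folklore] -/
theorem itemOf_eq (hC : Code Q pN L I r) (k : ℕ) (y : List Bool) {Y : List Bool}
    (hY : Y ∈ (M.PC.kernel 0 (uOf I r k y)).support) (j : Fin (pN.eval I.n)) :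
    StagePost.itemOf M.Pc I r k y Y j = vecCode I.n (vOf M I r k y Y j) ∧
      (vecCode I.n (vOf M I r k y Y j)).length ≤ L.eval (GapSVPInstance.encode (I, r)).length := by
  have hjK : (j : ℕ) < PolyCopiesIdx.K M.Pc (uOf I r k y).length := lt_trans j.isLt (N_lt_K M I r k y)
  have hs := segment_mem_support M (uOf I r k y) hY ⟨j, hjK⟩
  rw [inputIdx_eq M I r k y] at hs
  obtain ⟨hpre, hlen⟩ := hC k y j _ hs
  refine ⟨?_, hlen⟩
  rw [StagePost.itemOf, offOf_eq_blk M I r k y, GIVPBlocks.drop_blk_eq_segment_append, GIVPBlocks.fstF_eq_of_prefix hpre]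
  rfl

/-- **Under (CODE), the post-processed string is the batch code of the decoded segments, padded.**
[cite: Regev2009, Theorem 3.1 (proof, p. 15)] -/
theorem postG_eq (hC : Code Q pN L I r) (k : ℕ) (y : List Bool) {Y : List Bool}
    (hY : Y ∈ (M.PC.kernel 0 (uOf I r k y)).support) :
    StagePost.postG M.Pc pN (mSOf pN L) (boolPair (StagePost.zOf I r k y) Y) =
      encBatch I.n (pN.eval I.n) (vOf M I r k y Y) ++ ones ((mSOf pN L).eval (GapSVPInstance.encode (I, r)).length) :=
  StagePost.postG_ctx_of_items M.Pc pN (mSOf pN L) I r k y Y fun j => (itemOf_eq hC k y hY j).1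

/-- **The batch code of the decoded segments fits in the window.** [folklore] -/
theorem length_encBatch_vOf_le (hC : Code Q pN L I r) (k : ℕ) (y : List Bool) {Y : List Bool}
    (hY : Y ∈ (M.PC.kernel 0 (uOf I r k y)).support) :
    (encBatch I.n (pN.eval I.n) (vOf M I r k y Y)).length ≤ (mSOf pN L).eval (GapSVPInstance.encode (I, r)).length := by
  refine (length_encBatch_le _ fun j => (itemOf_eq hC k y hY j).2).trans ?_
  rw [eval_mSOf]
  exact Nat.mul_le_mul_right _ (TM2Iter.eval_mono pN (StagePost.n_le_length_encode I r))

/-- **The window of a string with the post-processed string in front** is the batch code, padded with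
ones to the window length. [folklore] -/
theorem window_of_prefix (hC : Code Q pN L I r) (k : ℕ) (y : List Bool) {Y : List Bool}
    (hY : Y ∈ (M.PC.kernel 0 (uOf I r k y)).support) {w : List Bool}
    (hw : StagePost.postG M.Pc pN (mSOf pN L) (boolPair (StagePost.zOf I r k y) Y) <+: w) :
    w.takeD ((mSOf pN L).eval (GapSVPInstance.encode (I, r)).length) false =
      encBatch I.n (pN.eval I.n) (vOf M I r k y Y) ++
        ones ((mSOf pN L).eval (GapSVPInstance.encode (I, r)).length - (encBatch I.n (pN.eval I.n) (vOf M I r k y Y)).length) := by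
  rw [postG_eq hC k y hY] at hw
  obtain ⟨rest, rfl⟩ := hw
  have hle := length_encBatch_vOf_le (M := M) hC k y hY
  set A := encBatch I.n (pN.eval I.n) (vOf M I r k y Y)
  set mW := (mSOf pN L).eval (GapSVPInstance.encode (I, r)).length
  rw [SeqChain.takeD_eq_take_append, List.append_assoc, List.take_append, List.take_of_length_le hle,
    List.take_append_of_le_length (by rw [ones, List.length_replicate]; omega), ones, List.take_replicate,
    min_eq_left (Nat.sub_le _ _)]
  have hlen : mW ≤ (A ++ (List.replicate mW true ++ rest)).length := by simp; omega
  rw [Nat.sub_eq_zero_of_le hlen, List.replicate_zero, List.append_nil]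

/-- **The windows of the possible outputs of the stage family are canonically padded batch codes.**
[folklore] -/
theorem exists_window_eq (hC : Code Q pN L I r) (k : ℕ) (y : List Bool) {w : List Bool}
    (hw : w ∈ ((M.S).kernel (StagePost.zOf I r k y)).support) :
    ∃ Y ∈ (M.PC.kernel 0 (uOf I r k y)).support,
      w.takeD ((mSOf pN L).eval (GapSVPInstance.encode (I, r)).length) false =
        encBatch I.n (pN.eval I.n) (vOf M I r k y Y) ++
          ones ((mSOf pN L).eval (GapSVPInstance.encode (I, r)).length -
            (encBatch I.n (pN.eval I.n) (vOf M I r k y Y)).length) := by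
  obtain ⟨Y, hY, hpre⟩ := exists_of_mem_support_S' M I r k y hw
  exact ⟨Y, hY, window_of_prefix hC k y hY hpre⟩

/-- Reading the batch off such a window. [folklore] -/
theorem readBatchE_window (hC : Code Q pN L I r) (k : ℕ) (y : List Bool) {Y : List Bool}
    (hY : Y ∈ (M.PC.kernel 0 (uOf I r k y)).support) {w : List Bool}
    (hw : StagePost.postG M.Pc pN (mSOf pN L) (boolPair (StagePost.zOf I r k y) Y) <+: w) :
    readBatchE (encBatch I.n (pN.eval I.n)) (w.takeD ((mSOf pN L).eval (GapSVPInstance.encode (I, r)).length) false) =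
      some (batchToE I.n (pN.eval I.n) (vOf M I r k y Y)) := by
  rw [window_of_prefix hC k y hY hw]
  exact readBatchE_append (fun _ _ _ h h' => encBatch_eq_of_prefix h h') _ _

/-- **The decoded batch law of the stage IS the push-forward of the law of the copies' register**
(`CWrap.map_kernel_eq_of_read`: the batch read off the window is a function of the `g`-prefix).
[cite: BernsteinVazirani1997, §8 (classical post-processing inside quantum machines)] -/
theorem map_readBatchE_window_eq (hC : Code Q pN L I r) (k : ℕ) (y : List Bool) :
    (((M.S).kernel (StagePost.zOf I r k y)).map fun w =>
        w.takeD ((mSOf pN L).eval (GapSVPInstance.encode (I, r)).length) false).map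
        (readBatchE (encBatch I.n (pN.eval I.n))) =
      (M.PC.kernel 0 (uOf I r k y)).map fun Y => some (batchToE I.n (pN.eval I.n) (vOf M I r k y Y)) := by
  rw [PMF.map_comp]
  change ((CWrap.family M.Pout).kernel 0 _).map _ = _
  rw [CWrap.map_kernel_eq_of_read M.Pout _ _ (fun Y => some (batchToE I.n (pN.eval I.n) (vOf M I r k y Y))), M.hPF', h_zOf M]
  intro Y hY w hw
  rw [M.hPF', h_zOf M] at hY
  rw [M.hPg'] at hw
  exact readBatchE_window hC k y hY hw

/-! ### The product law of the decoded segments -/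

/-- Restriction of an independent product to its first `N` coordinates. [folklore] -/
theorem indepLaw_map_restrict {β : Type} {K N : ℕ} (hNK : N ≤ K) (p : Fin K → PMF β) :
    (indepLaw K p).map (fun v => fun j : Fin N => v ⟨j, lt_of_lt_of_le j.isLt hNK⟩) =
      indepLaw N fun j => p ⟨j, lt_of_lt_of_le j.isLt hNK⟩ := by
  obtain ⟨d, rfl⟩ : ∃ d, K = N + d := ⟨K - N, by omega⟩
  have h := indepLaw_map_castAdd (a := N) (b := d) p
  have e : (fun v : Fin (N + d) → β => fun j : Fin N => v (Fin.castAdd d j)) =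
      fun v => fun j : Fin N => v ⟨j, lt_of_lt_of_le j.isLt hNK⟩ := by
    funext v j; rfl
  rw [e] at h
  rw [h]
  rfl

/-- **The decoded segments are independent, the `j`-th with the decoded output law of `Q` on
`⟨z, e_j⟩`.** [cite: NielsenChuang2010, §2.2.8 (measurement statistics of a product state)] -/
theorem map_vOf_eq_indepLaw (k : ℕ) (y : List Bool) :
    (M.PC.kernel 0 (uOf I r k y)).map (vOf M I r k y) =
      indepLaw (pN.eval I.n) fun j => (Q.kernel (boolPair (StagePost.zOf I r k y)
        (idxWord (KOf pN (GapSVPInstance.encode (I, r)) k y) j))).map (decodeLatticeVector I.n) := by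
  have hNK := (N_lt_K M I r k y).le
  have hcomp : vOf M I r k y =
      (fun t : Fin (PolyCopiesIdx.K M.Pc (uOf I r k y).length) → (Fin I.n → ℤ) =>
        fun j : Fin (pN.eval I.n) => t ⟨j, lt_of_lt_of_le j.isLt hNK⟩) ∘
      ((fun t : Fin (PolyCopiesIdx.K M.Pc (uOf I r k y).length) → List Bool => fun j => decodeLatticeVector I.n (t j)) ∘
        fun Y => fun j : Fin (PolyCopiesIdx.K M.Pc (uOf I r k y).length) =>
          PolyCopiesIdx.segment M.Pc (uOf I r k y).length Y j) := rfl
  rw [hcomp, ← PMF.map_comp, ← PMF.map_comp]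
  change PMF.map _ (PMF.map _ (PMF.map _ ((PolyCopiesIdx.family M.Pc).kernel 0 (uOf I r k y)))) = _
  rw [PolyCopiesIdx.kernel_map_segments]
  have h1 : (indepLaw (PolyCopiesIdx.K M.Pc (uOf I r k y).length) fun j => PolyCopiesIdx.blockLaw M.Pc (uOf I r k y) j).map
      (fun t : Fin (PolyCopiesIdx.K M.Pc (uOf I r k y).length) → List Bool => fun j => decodeLatticeVector I.n (t j)) =
      indepLaw (PolyCopiesIdx.K M.Pc (uOf I r k y).length)
        fun j => (PolyCopiesIdx.blockLaw M.Pc (uOf I r k y) j).map (decodeLatticeVector I.n) :=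
    indepLaw_map_pi _ _ fun _ => decodeLatticeVector I.n
  rw [h1, indepLaw_map_restrict hNK]
  refine congrArg (indepLaw (pN.eval I.n)) (funext fun j => ?_)
  rw [PolyCopiesIdx.blockLaw_eq_kernel, inputIdx_eq M I r k y]
  rfl

end Laws

/-! ### The four kernel-level clauses -/

section Clauses

variable {Q : UniformQCircuitFamily} {pN L : Polynomial ℕ} {M : Machine Q pN L} {I : LatticeInstance} {r : ℚ}

/-- An independent product of point masses is the point mass of the tuple. [folklore] -/
theorem indepLaw_pure {β : Type} : ∀ (N : ℕ) (b : Fin N → β), indepLaw N (fun j => PMF.pure (b j)) = PMF.pure b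
  | 0, b => by rw [indepLaw_zero]; exact congrArg PMF.pure (Subsingleton.elim _ _)
  | N + 1, b => by
    rw [indepLaw_succ, PMF.pure_bind, indepLaw_pure N (fun j => b j.succ), PMF.pure_map]
    exact congrArg PMF.pure (Fin.cons_self_tail b)

/-- `min 1 (N t) ≤ N · min 1 t` for `N ≥ 1`. [folklore] -/
theorem min_one_mul_le {N : ℕ} (hN : 0 < N) (t : ℝ) : min 1 ((N : ℝ) * t) ≤ N * min 1 t := by
  have hN1 : (1 : ℝ) ≤ N := by exact_mod_cast hN
  rcases le_total t 1 with h | h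
  · rw [min_eq_right h]; exact min_le_right _ _
  · rw [min_eq_left h, mul_one]; exact (min_le_left _ _).trans hN1

/-- **The decoded batch law of the stage, as the embedded independent product of the one-copy decoded
laws** (under (CODE)). [cite: Regev2009, Theorem 3.1 (proof, p. 15)] -/
theorem map_readBatchE_window_eq_map_indepLaw (hC : Code Q pN L I r) (k : ℕ) (y : List Bool) :
    (((M.S).kernel (StagePost.zOf I r k y)).map fun w =>
        w.takeD ((mSOf pN L).eval (GapSVPInstance.encode (I, r)).length) false).map
        (readBatchE (encBatch I.n (pN.eval I.n))) =
      (indepLaw (pN.eval I.n) fun j => (Q.kernel (boolPair (StagePost.zOf I r k y)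
        (idxWord (KOf pN (GapSVPInstance.encode (I, r)) k y) j))).map (decodeLatticeVector I.n)).map
        fun b => some (batchToE I.n (pN.eval I.n) b) := by
  rw [map_readBatchE_window_eq hC k y, ← map_vOf_eq_indepLaw, PMF.map_comp]
  rfl

/-- **(BOOT) from (BOOT₁)**: if each of the first `N` copies, run on `⟨⟨x, ⟨1⁰, ε⟩⟩, e_j⟩`, decodes to a
vector `ν`-close in law to `D_{L,ρ₀}`, the decoded batch of the stage is `N ν`-close to `D_{L,ρ₀}^{⊗N}`
(hybrid argument over independent copies). [cite: Goldreich2001, §3.2.3 (hybrid argument)] -/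
theorem boot_of_oneCopy (hC : Code Q pN L I r) {ρ ν : ℝ}
    (hB : ∀ j : ℕ, j < pN.eval I.n →
      ((Q.kernel (boolPair (stageInput (GapSVPInstance.encode (I, r)) 0 [])
          (idxWord (KOf pN (GapSVPInstance.encode (I, r)) 0 []) j))).map
          (decodeLatticeVector I.n)).tvDist ((discreteGaussian I.lattice ρ 0).map I.intCoords) ≤ ν) :
    ((((M.S).kernel (stageInput (GapSVPInstance.encode (I, r)) 0 [])).map fun w =>
        w.takeD ((mSOf pN L).eval (GapSVPInstance.encode (I, r)).length) false).map
        (readBatchE (encBatch I.n (pN.eval I.n)))).tvDist (idealBatch I (pN.eval I.n) ρ) ≤ pN.eval I.n * ν := by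
  rw [show stageInput (GapSVPInstance.encode (I, r)) 0 [] = StagePost.zOf I r 0 [] from rfl,
    map_readBatchE_window_eq_map_indepLaw hC 0 [], idealBatch_eq_map_idealBatchZ, idealBatchZ, ← LWE.indepLaw_const]
  refine (PMF.tvDist_map_le_holds _ _ _).trans ((tvDist_indepLaw_le _ _ _).trans ?_)
  calc ∑ j : Fin (pN.eval I.n), ((Q.kernel (boolPair (StagePost.zOf I r 0 [])
          (idxWord (KOf pN (GapSVPInstance.encode (I, r)) 0 []) j))).map (decodeLatticeVector I.n)).tvDist
          ((discreteGaussian I.lattice ρ 0).map I.intCoords)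
      ≤ ∑ _j : Fin (pN.eval I.n), ν := Finset.sum_le_sum fun j _ => hB j j.isLt
    _ = pN.eval I.n * ν := by rw [Finset.sum_const, Finset.card_univ, Fintype.card_fin, nsmul_eq_mul]

/-- The possible windows are padded batch codes of SHORT batches, which the reader reads. [folklore] -/
theorem exists_eq_of_mem_support (hC : Code Q pN L I r) {k : ℕ} {y : List Bool}
    (hy : ∃ y₀ : List Bool, y ∈ (((M.S).kernel (stageInput (GapSVPInstance.encode (I, r)) k y₀)).map fun w =>
      w.takeD ((mSOf pN L).eval (GapSVPInstance.encode (I, r)).length) false).support) :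
    ∃ b : Fin (pN.eval I.n) → Fin I.n → ℤ,
      (∀ j, (vecCode I.n (b j)).length ≤ L.eval (GapSVPInstance.encode (I, r)).length) ∧
      y = encBatch I.n (pN.eval I.n) b ++ ones ((mSOf pN L).eval (GapSVPInstance.encode (I, r)).length -
        (encBatch I.n (pN.eval I.n) b).length) ∧
      readBatch I.n (pN.eval I.n) y = b := by
  obtain ⟨y₀, hy⟩ := hy
  rw [PMF.mem_support_map_iff] at hy
  obtain ⟨w, hw, rfl⟩ := hy
  obtain ⟨Y, hY, hwin⟩ := exists_window_eq (M := M) hC k y₀ hw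
  refine ⟨vOf M I r k y₀ Y, fun j => (itemOf_eq hC k y₀ hY j).2, hwin, ?_⟩
  rw [hwin]
  exact readBatch_append _ _

/-- **(FAC)**: possible windows with the same decoded batch are equal (they are canonical), so the next
stage's decoded laws agree. [folklore] -/
theorem fac_of_oneCopy (hC : Code Q pN L I r) (k : ℕ) {y y' : List Bool}
    (hy : ∃ y₀ : List Bool, y ∈ (((M.S).kernel (stageInput (GapSVPInstance.encode (I, r)) k y₀)).map fun w =>
      w.takeD ((mSOf pN L).eval (GapSVPInstance.encode (I, r)).length) false).support)
    (hy' : ∃ y₀ : List Bool, y' ∈ (((M.S).kernel (stageInput (GapSVPInstance.encode (I, r)) k y₀)).map fun w =>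
      w.takeD ((mSOf pN L).eval (GapSVPInstance.encode (I, r)).length) false).support)
    (hread : readBatch I.n (pN.eval I.n) y = readBatch I.n (pN.eval I.n) y') : y = y' := by
  obtain ⟨b, -, hyb, hrb⟩ := exists_eq_of_mem_support (M := M) hC hy
  obtain ⟨b', -, hyb', hrb'⟩ := exists_eq_of_mem_support (M := M) hC hy'
  rw [hrb, hrb'] at hread
  rw [hyb, hyb', hread]

/-- **(STEP) from (STEP₁)**: on a possible window `y` (a padded batch code of a short batch `b`), if
each copy run on `⟨⟨x, ⟨1^{k+1}, y⟩⟩, e_j⟩` decodes to a vector `F₁(b)`-close to `D_{L,ρ'}`, the decoded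
batch of stage `k+1` is `N F₁(b)`-close to `D_{L,ρ'}^{⊗N}`. [cite: Goldreich2001, §3.2.3 (hybrid argument)] -/
theorem step_of_oneCopy (hC : Code Q pN L I r) (k : ℕ) {ρ' : ℝ} {F₁ : (Fin (pN.eval I.n) → Fin I.n → ℤ) → ℝ}
    (hS : ∀ b : Fin (pN.eval I.n) → Fin I.n → ℤ,
      (∀ j, (vecCode I.n (b j)).length ≤ L.eval (GapSVPInstance.encode (I, r)).length) →
      ∀ (pad : List Bool) (j : ℕ), j < pN.eval I.n →
        ((Q.kernel (boolPair (stageInput (GapSVPInstance.encode (I, r)) (k + 1) (encBatch I.n (pN.eval I.n) b ++ pad))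
            (idxWord (KOf pN (GapSVPInstance.encode (I, r)) (k + 1) (encBatch I.n (pN.eval I.n) b ++ pad)) j))).map
            (decodeLatticeVector I.n)).tvDist
          ((discreteGaussian I.lattice ρ' 0).map I.intCoords) ≤ F₁ b)
    {y : List Bool}
    (hy : ∃ y₀ : List Bool, y ∈ (((M.S).kernel (stageInput (GapSVPInstance.encode (I, r)) k y₀)).map fun w =>
      w.takeD ((mSOf pN L).eval (GapSVPInstance.encode (I, r)).length) false).support) :
    ((((M.S).kernel (stageInput (GapSVPInstance.encode (I, r)) (k + 1) y)).map fun w =>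
        w.takeD ((mSOf pN L).eval (GapSVPInstance.encode (I, r)).length) false).map
        (readBatchE (encBatch I.n (pN.eval I.n)))).tvDist (idealBatch I (pN.eval I.n) ρ') ≤
      pN.eval I.n * F₁ (readBatch I.n (pN.eval I.n) y) := by
  obtain ⟨b, hshort, hyb, hrb⟩ := exists_eq_of_mem_support (M := M) hC hy
  rw [hrb, show stageInput (GapSVPInstance.encode (I, r)) (k + 1) y = StagePost.zOf I r (k + 1) y from rfl,
    map_readBatchE_window_eq_map_indepLaw hC (k + 1) y, idealBatch_eq_map_idealBatchZ, idealBatchZ, ← LWE.indepLaw_const]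
  refine (PMF.tvDist_map_le_holds _ _ _).trans ((tvDist_indepLaw_le _ _ _).trans ?_)
  calc ∑ j : Fin (pN.eval I.n), ((Q.kernel (boolPair (StagePost.zOf I r (k + 1) y)
          (idxWord (KOf pN (GapSVPInstance.encode (I, r)) (k + 1) y) j))).map (decodeLatticeVector I.n)).tvDist
          ((discreteGaussian I.lattice ρ' 0).map I.intCoords)
      ≤ ∑ _j : Fin (pN.eval I.n), F₁ b := Finset.sum_le_sum fun j _ => by
          have h := hS b hshort (ones ((mSOf pN L).eval (GapSVPInstance.encode (I, r)).length -
            (encBatch I.n (pN.eval I.n) b).length)) j j.isLt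
          rw [← hyb] at h
          exact h
    _ = pN.eval I.n * F₁ b := by rw [Finset.sum_const, Finset.card_univ, Fintype.card_fin, nsmul_eq_mul]

/-- **(PASS) from (PASS₁)**: if every copy run on `⟨⟨x, ⟨1^{k+1}, y⟩⟩, e_j⟩` writes back vector `j` of the
batch read off `y`, the decoded batch of stage `k+1` is that batch, surely. [folklore] -/
theorem pass_of_oneCopy (hC : Code Q pN L I r) (k : ℕ)
    (hP : ∀ b : Fin (pN.eval I.n) → Fin I.n → ℤ,
      (∀ j, (vecCode I.n (b j)).length ≤ L.eval (GapSVPInstance.encode (I, r)).length) →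
      ∀ (pad : List Bool) (j : ℕ) (hj : j < pN.eval I.n),
        (Q.kernel (boolPair (stageInput (GapSVPInstance.encode (I, r)) (k + 1) (encBatch I.n (pN.eval I.n) b ++ pad))
            (idxWord (KOf pN (GapSVPInstance.encode (I, r)) (k + 1) (encBatch I.n (pN.eval I.n) b ++ pad)) j))).map
            (decodeLatticeVector I.n) =
          PMF.pure (b ⟨j, hj⟩))
    {y : List Bool}
    (hy : ∃ y₀ : List Bool, y ∈ (((M.S).kernel (stageInput (GapSVPInstance.encode (I, r)) k y₀)).map fun w =>
      w.takeD ((mSOf pN L).eval (GapSVPInstance.encode (I, r)).length) false).support) :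
    ((((M.S).kernel (stageInput (GapSVPInstance.encode (I, r)) (k + 1) y)).map fun w =>
        w.takeD ((mSOf pN L).eval (GapSVPInstance.encode (I, r)).length) false).map
        (readBatchE (encBatch I.n (pN.eval I.n)))) =
      PMF.pure (some (batchToE I.n (pN.eval I.n) (readBatch I.n (pN.eval I.n) y))) := by
  obtain ⟨b, hshort, hyb, hrb⟩ := exists_eq_of_mem_support (M := M) hC hy
  rw [hrb, show stageInput (GapSVPInstance.encode (I, r)) (k + 1) y = StagePost.zOf I r (k + 1) y from rfl,
    map_readBatchE_window_eq_map_indepLaw hC (k + 1) y]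
  have hcoord : (fun j : Fin (pN.eval I.n) => (Q.kernel (boolPair (StagePost.zOf I r (k + 1) y)
      (idxWord (KOf pN (GapSVPInstance.encode (I, r)) (k + 1) y) j))).map (decodeLatticeVector I.n)) =
      fun j => PMF.pure (b j) := by
    funext j
    have h := hP b hshort (ones ((mSOf pN L).eval (GapSVPInstance.encode (I, r)).length -
      (encBatch I.n (pN.eval I.n) b).length)) j j.isLt
    rw [← hyb] at h
    exact h
  rw [hcoord, indepLaw_pure, PMF.pure_map]

/-- **The averaged per-batch bound**: `E[min 1 (N F₁)] ≤ N · E[min 1 F₁]`. [folklore] -/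
theorem tsum_min_one_mul_le {N : ℕ} (hN : 0 < N) (p : PMF (Fin N → Fin I.n → ℤ)) {F₁ : (Fin N → Fin I.n → ℤ) → ℝ}
    (hF : ∀ b, 0 ≤ F₁ b) :
    ∑' b, (p b).toReal * min 1 ((N : ℝ) * F₁ b) ≤ N * ∑' b, (p b).toReal * min 1 (F₁ b) := by
  have hs1 : Summable fun b => (p b).toReal * min 1 ((N : ℝ) * F₁ b) :=
    PMF.summable_toReal_mul_of_abs_le_one _ fun b => by
      rw [abs_of_nonneg (le_min zero_le_one (mul_nonneg (Nat.cast_nonneg _) (hF b)))]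
      exact min_le_left _ _
  have hs2 : Summable fun b => (p b).toReal * min 1 (F₁ b) :=
    PMF.summable_toReal_mul_of_abs_le_one _ fun b => by
      rw [abs_of_nonneg (le_min zero_le_one (hF b))]
      exact min_le_left _ _
  rw [← tsum_mul_left]
  refine hs1.tsum_le_tsum (fun b => ?_) (hs2.mul_left _)
  rw [mul_left_comm]
  exact mul_le_mul_of_nonneg_left (min_one_mul_le hN (F₁ b)) ENNReal.toReal_nonneg

end Clauses

/-! ### The kernel-level laws from a one-sample stage machine -/

section Main

variable (q : ℕ → ℕ) [∀ n, NeZero (q n)] (α : ℕ → ℝ)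

/-- **The kernel-level hypothesis of `thm_3_1_stage_of_kernelLaws` from a ONE-SAMPLE stage machine.**
Given, for the parameters at hand, a uniform family `Q`, polynomials `p_N` (batch size `N = p_N(n) ≥ 1`)
and `L` (code length), a negligible `ν₁` and ratios `θ(n) ≥ αq/√n` such that for all large `n` and every
instance: (CODE) every output of `Q` on a copy input starts with a framed vector code of length
`≤ L(|x|)`; (BOOT₁) at stage `0` each copy `j < N` decodes to a vector `ν₁`-close to `D_{L,ρ₀}` when
`ρ₀ > 2^{2n}λₙ` (Lemma 3.2 for ONE sample); (STEP₁) at a quantum stage `k+1 ≤ 3n` with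
`ρ_k > √2 q η_ε`, on every padded batch code of a short batch `b`, each copy `j < N` decodes to a vector
`F₁(b)`-close to `D_{L,ρ_{k+1}}`, `F₁ ≥ 0`, `E_{b∼D_{L,ρ_k}^{⊗N}}[min 1 F₁] ≤ ν₁` (Lemma 3.3 for ONE sample,
given the samples); (PASS₁) at a padding stage each copy `j` writes vector `j` back — the stage family
`S = CWrap(⟨·,ε⟩, PolyCopiesIdx(Q), postG)` satisfies (BOOT)/(FAC)/(STEP)/(PASS) with `N = p_N(n)`,
`mS = p_N(2L+2)`, `ν_S = N ν₁`, `F = N F₁` (`boot_of_oneCopy`, `fac_of_oneCopy`, `step_of_oneCopy`,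
`pass_of_oneCopy`, `tsum_min_one_mul_le`). [cite: Regev2009, Theorem 3.1 (proof, p. 15) with Lemma 3.3 and the note after it] -/
theorem kernelLaws_of_oneCopy
    (hQ : ∀ (m : ℕ → ℕ) (_ : IsPolyBounded m) (_ : IsPolyTimeParams q α m)
      (_ : ∀ᶠ n : ℕ in atTop, 0 < α n ∧ α n < 1 ∧ 2 * Real.sqrt n < α n * q n)
      (_ : ∃ (W : UniformQCircuitFamily) (c : ℝ), 0 < c ∧
        W.SolvesSearchLWEWorstCase q (fun n => discretizedGaussian (q n) (α n)) m
          fun n => (2 : ℝ) ^ (-(c * n)))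
      (ε : ℕ → ℝ), IsNegligible ε → (∀ n, 0 < ε n) →
      ∃ (Q : UniformQCircuitFamily) (pN L : Polynomial ℕ) (ν₁ θ : ℕ → ℝ),
        IsNegligible ν₁ ∧ (∀ n, 0 < pN.eval n) ∧ (∀ n, 0 < n → α n * q n / Real.sqrt n ≤ θ n) ∧
        ∀ᶠ n : ℕ in atTop, ∀ (I : LatticeInstance) (r : ℚ) (x : List Bool), I.n = n → I.IsNonsingular →
          x = GapSVPInstance.encode (I, r) →
          Code Q pN L I r ∧
          ((2 : ℝ) ^ (2 * I.n) * successiveMinimum I.lattice I.n < levelRadius (θ I.n) (3 * I.n) r 0 →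
            ∀ j : ℕ, j < pN.eval I.n →
              ((Q.kernel (boolPair (stageInput x 0 []) (idxWord (KOf pN x 0 []) j))).map (decodeLatticeVector I.n)).tvDist
                ((discreteGaussian I.lattice (levelRadius (θ I.n) (3 * I.n) r 0) 0).map I.intCoords) ≤ ν₁ I.n) ∧
          (∀ k, k < 3 * I.n →
            Real.sqrt 2 * q I.n * smoothingParameter I.lattice (ε I.n) < levelRadius (θ I.n) (3 * I.n) r k →
            ∃ F₁ : (Fin (pN.eval I.n) → Fin I.n → ℤ) → ℝ, (∀ b, 0 ≤ F₁ b) ∧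
              (∀ b : Fin (pN.eval I.n) → Fin I.n → ℤ, (∀ j, (vecCode I.n (b j)).length ≤ L.eval x.length) →
                ∀ (pad : List Bool) (j : ℕ), j < pN.eval I.n →
                  ((Q.kernel (boolPair (stageInput x (k + 1) (encBatch I.n (pN.eval I.n) b ++ pad))
                      (idxWord (KOf pN x (k + 1) (encBatch I.n (pN.eval I.n) b ++ pad)) j))).map
                      (decodeLatticeVector I.n)).tvDist
                    ((discreteGaussian I.lattice (levelRadius (θ I.n) (3 * I.n) r (k + 1)) 0).map I.intCoords) ≤ F₁ b) ∧
              ∑' b, (idealBatchZ I (pN.eval I.n) (levelRadius (θ I.n) (3 * I.n) r k) b).toReal * min 1 (F₁ b) ≤ ν₁ I.n) ∧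
          (∀ k, 3 * I.n ≤ k → ∀ b : Fin (pN.eval I.n) → Fin I.n → ℤ,
            (∀ j, (vecCode I.n (b j)).length ≤ L.eval x.length) →
            ∀ (pad : List Bool) (j : ℕ) (hj : j < pN.eval I.n),
              (Q.kernel (boolPair (stageInput x (k + 1) (encBatch I.n (pN.eval I.n) b ++ pad))
                  (idxWord (KOf pN x (k + 1) (encBatch I.n (pN.eval I.n) b ++ pad)) j))).map
                  (decodeLatticeVector I.n) = PMF.pure (b ⟨j, hj⟩))) :
    ∀ (m : ℕ → ℕ) (_ : IsPolyBounded m) (_ : IsPolyTimeParams q α m)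
      (_ : ∀ᶠ n : ℕ in atTop, 0 < α n ∧ α n < 1 ∧ 2 * Real.sqrt n < α n * q n)
      (_ : ∃ (W : UniformQCircuitFamily) (c : ℝ), 0 < c ∧
        W.SolvesSearchLWEWorstCase q (fun n => discretizedGaussian (q n) (α n)) m
          fun n => (2 : ℝ) ^ (-(c * n)))
      (ε : ℕ → ℝ), IsNegligible ε → (∀ n, 0 < ε n) →
      ∃ (S : UniformQCircuitFamily) (N : ℕ → ℕ) (mS : Polynomial ℕ)
        (encB : (n : ℕ) → (Fin (N n) → Fin n → ℤ) → List Bool)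
        (readB : (n : ℕ) → List Bool → (Fin (N n) → Fin n → ℤ)) (νS : ℕ → ℝ) (θ : ℕ → ℝ),
        IsNegligible νS ∧ (∀ n, 0 < n → α n * q n / Real.sqrt n ≤ θ n) ∧
        (∀ n (b b' : Fin (N n) → Fin n → ℤ) (z : List Bool), encB n b <+: z → encB n b' <+: z → b = b') ∧
        (∀ n (b : Fin (N n) → Fin n → ℤ) (w : List Bool) (j : Fin (N n)), (j : ℕ) = 0 →
          decodeLatticeVector n (encB n b ++ w) = b j) ∧
        (∀ n, 0 < N n) ∧
        (∀ n (b : Fin (N n) → Fin n → ℤ) (w : List Bool), readB n (encB n b ++ w) = b) ∧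
        (∀ n (y : List Bool), (¬ ∃ b, encB n b <+: y) → readB n y = 0) ∧
        ∀ᶠ n : ℕ in atTop, ∀ (I : LatticeInstance) (r : ℚ) (x : List Bool), I.n = n → I.IsNonsingular →
          x = GapSVPInstance.encode (I, r) →
          -- (BOOT) Lemma 3.2 in machine form, at the kernel of stage `0`
          ((2 : ℝ) ^ (2 * I.n) * successiveMinimum I.lattice I.n < levelRadius (θ I.n) (3 * I.n) r 0 →
            (((S.kernel (stageInput x 0 [])).map fun w => w.takeD (mS.eval x.length) false).map
                (readBatchE (encB I.n))).tvDist
              (idealBatch I (N I.n) (levelRadius (θ I.n) (3 * I.n) r 0)) ≤ νS I.n) ∧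
          -- (FAC) the decoded output law depends on the previous window only through the batch read off it
          (∀ (k : ℕ) (y y' : List Bool),
            (∃ y₀ : List Bool, y ∈ ((S.kernel (stageInput x k y₀)).map fun w => w.takeD (mS.eval x.length) false).support) →
            (∃ y₀ : List Bool, y' ∈ ((S.kernel (stageInput x k y₀)).map fun w => w.takeD (mS.eval x.length) false).support) →
            readB I.n y = readB I.n y' →
            (((S.kernel (stageInput x (k + 1) y)).map fun w => w.takeD (mS.eval x.length) false).map
                (readBatchE (encB I.n))) =
              ((S.kernel (stageInput x (k + 1) y')).map fun w => w.takeD (mS.eval x.length) false).map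
                (readBatchE (encB I.n))) ∧
          -- (STEP) Lemma 3.3 in machine form: per-batch error, negligible on average over ideal batches
          (∀ k, k < 3 * I.n →
            Real.sqrt 2 * q I.n * smoothingParameter I.lattice (ε I.n) < levelRadius (θ I.n) (3 * I.n) r k →
            ∃ F : (Fin (N I.n) → Fin I.n → ℤ) → ℝ, (∀ b, 0 ≤ F b) ∧
              (∀ y : List Bool,
                (∃ y₀ : List Bool, y ∈ ((S.kernel (stageInput x k y₀)).map fun w => w.takeD (mS.eval x.length) false).support) →
                (((S.kernel (stageInput x (k + 1) y)).map fun w => w.takeD (mS.eval x.length) false).map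
                    (readBatchE (encB I.n))).tvDist
                  (idealBatch I (N I.n) (levelRadius (θ I.n) (3 * I.n) r (k + 1))) ≤ F (readB I.n y)) ∧
              ∑' b, (idealBatchZ I (N I.n) (levelRadius (θ I.n) (3 * I.n) r k) b).toReal * min 1 (F b) ≤
                νS I.n) ∧
          -- (PASS) padding stages write the batch back
          (∀ k, 3 * I.n ≤ k → ∀ y : List Bool,
            (∃ y₀ : List Bool, y ∈ ((S.kernel (stageInput x k y₀)).map fun w => w.takeD (mS.eval x.length) false).support) →
            (((S.kernel (stageInput x (k + 1) y)).map fun w => w.takeD (mS.eval x.length) false).map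
                (readBatchE (encB I.n))) =
              PMF.pure (some (batchToE I.n (N I.n) (readB I.n y)))) := by
  intro m hm hP hαq hW ε hε hε0
  obtain ⟨Q, pN, L, ν₁, θ, hν₁, hpN, hθ, hlaw⟩ := hQ m hm hP hαq hW ε hε hε0
  obtain ⟨M⟩ := nonempty_machine Q pN L
  refine ⟨M.S, fun n => pN.eval n, mSOf pN L, fun n => encBatch n (pN.eval n), fun n => readBatch n (pN.eval n),
    fun n => ((pN.eval n : ℕ) : ℝ) * ν₁ n, θ, ?_, hθ, fun n _ _ _ h h' => encBatch_eq_of_prefix h h', fun n b w j hj => ?_, hpN,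
    fun n b w => readBatch_append b w, fun n y h => readBatch_of_not_exists h, ?_⟩
  · -- `N ν₁` is negligible
    have h := hν₁.polynomial_mul (pN.map (Nat.castRingHom ℝ))
    have e : (fun n : ℕ => (pN.map (Nat.castRingHom ℝ)).eval (n : ℝ) * ν₁ n) = fun n : ℕ => ((pN.eval n : ℕ) : ℝ) * ν₁ n :=
      funext fun n => by rw [Polynomial.eval_natCast_map]; rfl
    rw [e] at h
    exact h
  · -- the `DGS` reader reads vector `0`
    rw [decodeLatticeVector_encBatch_append (hpN n)]
    exact congrArg b (Fin.ext hj.symm)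
  · filter_upwards [hlaw] with n hn I r x hIn hI hx
    obtain ⟨hC, hB, hS, hPas⟩ := hn I r x hIn hI hx
    subst hx
    refine ⟨fun h0 => boot_of_oneCopy (M := M) hC (hB h0), fun k y y' hy hy' hread => ?_, fun k hk hsm => ?_,
      fun k hk y hy => pass_of_oneCopy (M := M) hC k (hPas k hk) hy⟩
    · rw [fac_of_oneCopy (M := M) hC k hy hy' hread]
    · obtain ⟨F₁, hF0, hF, hEF⟩ := hS k hk hsm
      refine ⟨fun b => ((pN.eval I.n : ℕ) : ℝ) * F₁ b, fun b => mul_nonneg (Nat.cast_nonneg _) (hF0 b),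
        fun y hy => step_of_oneCopy (M := M) hC k hF hy, ?_⟩
      exact (tsum_min_one_mul_le (hpN I.n) _ hF0).trans (mul_le_mul_of_nonneg_left hEF (Nat.cast_nonneg _))

end Main

end StageCopies

end Regev2009

/-! ### pqc.S19 (SIVP form) from a one-sample stage machine -/

section Corollary

variable (q : ℕ → ℕ) [∀ n, NeZero (q n)] (α : ℕ → ℝ) (m : ℕ → ℕ)

open Filter QuantumComplexity Literature.Algebra.EuclideanLattices Literature.Computability.Cryptography.LWE
  Literature.Computability.Complexity

/-- **pqc.S19 (SIVP form) from a ONE-SAMPLE stage machine**: `regev_lwe_to_sivp_quantum_of_kernelLaws ∘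
StageCopies.kernelLaws_of_oneCopy`. What remains of Regev's Theorem 1.1 (SIVP) after this file is the
one-sample machine: the bootstrap sampler (Lemma 3.2), the quantum iterative step (Lemmas 3.4 + 3.14)
and the identity, dispatched on the stage index, as ONE uniform family with the four one-copy
properties. [cite: Regev2009, Thm 1.1 from Thm 3.1 (proof, p. 15), Lemmas 3.2, 3.3, 3.17] -/
theorem regev_lwe_to_sivp_quantum_of_oneCopy
    (hQ : ∀ (m : ℕ → ℕ) (_ : IsPolyBounded m) (_ : IsPolyTimeParams q α m)
      (_ : ∀ᶠ n : ℕ in atTop, 0 < α n ∧ α n < 1 ∧ 2 * Real.sqrt n < α n * q n)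
      (_ : ∃ (W : UniformQCircuitFamily) (c : ℝ), 0 < c ∧
        W.SolvesSearchLWEWorstCase q (fun n => discretizedGaussian (q n) (α n)) m
          fun n => (2 : ℝ) ^ (-(c * n)))
      (ε : ℕ → ℝ), IsNegligible ε → (∀ n, 0 < ε n) →
      ∃ (Q : UniformQCircuitFamily) (pN L : Polynomial ℕ) (ν₁ θ : ℕ → ℝ),
        IsNegligible ν₁ ∧ (∀ n, 0 < pN.eval n) ∧ (∀ n, 0 < n → α n * q n / Real.sqrt n ≤ θ n) ∧
        ∀ᶠ n : ℕ in atTop, ∀ (I : LatticeInstance) (r : ℚ) (x : List Bool), I.n = n → I.IsNonsingular →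
          x = GapSVPInstance.encode (I, r) →
          Regev2009.StageCopies.Code Q pN L I r ∧
          ((2 : ℝ) ^ (2 * I.n) * successiveMinimum I.lattice I.n < Regev2009.levelRadius (θ I.n) (3 * I.n) r 0 →
            ∀ j : ℕ, j < pN.eval I.n →
              ((Q.kernel (boolPair (stageInput x 0 []) (Regev2009.StageCopies.idxWord (Regev2009.StageCopies.KOf pN x 0 []) j))).map (decodeLatticeVector I.n)).tvDist
                ((discreteGaussian I.lattice (Regev2009.levelRadius (θ I.n) (3 * I.n) r 0) 0).map I.intCoords) ≤ ν₁ I.n) ∧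
          (∀ k, k < 3 * I.n →
            Real.sqrt 2 * q I.n * smoothingParameter I.lattice (ε I.n) < Regev2009.levelRadius (θ I.n) (3 * I.n) r k →
            ∃ F₁ : (Fin (pN.eval I.n) → Fin I.n → ℤ) → ℝ, (∀ b, 0 ≤ F₁ b) ∧
              (∀ b : Fin (pN.eval I.n) → Fin I.n → ℤ, (∀ j, (Regev2009.vecCode I.n (b j)).length ≤ L.eval x.length) →
                ∀ (pad : List Bool) (j : ℕ), j < pN.eval I.n →
                  ((Q.kernel (boolPair (stageInput x (k + 1) (Regev2009.encBatch I.n (pN.eval I.n) b ++ pad))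
                      (Regev2009.StageCopies.idxWord (Regev2009.StageCopies.KOf pN x (k + 1) (Regev2009.encBatch I.n (pN.eval I.n) b ++ pad)) j))).map
                      (decodeLatticeVector I.n)).tvDist
                    ((discreteGaussian I.lattice (Regev2009.levelRadius (θ I.n) (3 * I.n) r (k + 1)) 0).map I.intCoords) ≤ F₁ b) ∧
              ∑' b, (Regev2009.idealBatchZ I (pN.eval I.n) (Regev2009.levelRadius (θ I.n) (3 * I.n) r k) b).toReal * min 1 (F₁ b) ≤ ν₁ I.n) ∧
          (∀ k, 3 * I.n ≤ k → ∀ b : Fin (pN.eval I.n) → Fin I.n → ℤ,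
            (∀ j, (Regev2009.vecCode I.n (b j)).length ≤ L.eval x.length) →
            ∀ (pad : List Bool) (j : ℕ) (hj : j < pN.eval I.n),
              (Q.kernel (boolPair (stageInput x (k + 1) (Regev2009.encBatch I.n (pN.eval I.n) b ++ pad))
                  (Regev2009.StageCopies.idxWord (Regev2009.StageCopies.KOf pN x (k + 1) (Regev2009.encBatch I.n (pN.eval I.n) b ++ pad)) j))).map
                  (decodeLatticeVector I.n) = PMF.pure (b ⟨j, hj⟩))) :
    regev_lwe_to_sivp_quantum q α m :=
  regev_lwe_to_sivp_quantum_of_kernelLaws q α m (Regev2009.StageCopies.kernelLaws_of_oneCopy q α hQ)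

end Corollary

end Literature.Computability.Cryptography

end
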